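import Summits.CriticalPhenomena.CardyFormulaZ2.Theorems.CardyRotToConfR2SymmetryUpgradeMarkovChord
import Summits.CriticalPhenomena.CardyFormulaZ2.Theorems.CardyRotToConfR2SymmetryUpgradeMarkovKernelAE
import Summits.CriticalPhenomena.CardyFormulaZ2.Theorems.CardyRotToConfR2SymmetryUpgradeMarkovTransfer
import Summits.CriticalPhenomena.CardyFormulaZ2.Theorems.CardyRotToConfR2SymmetryUpgrade.Negative.SurgFatMarkovNormalize
import HarnessLib

/-!
# The fat-germ one-shot surgery is domain Markov
# (stub `stub_fatSurgeryMarkovCore` of line `germ-label-transport`, crux `CardyRotToConfR2SymmetryUpgrade`,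
# stmt-CriticalPhenomena-0698)

For an admissible chordal family `S` (chordal, similarity covariant, domain Markov, local, target
independent) whose laws charge only classes that trace no straight segment, have Lebesgue-null
trace and reach the target only at the very end, the fat-germ surgery `J = Negative.fatSurgery S`
has the typed domain Markov property, with the kernel `K = Negative.surgExt S Q` built in
`SurgFatMarkovKernel` from a NORMALISED Markov extension `Q` of `S`
(`exists_isMarkovExtension_normalized`). `initial` and `domain` hold by construction
(`surgExt_initial`, `surgExt_domain`); the disintegration `markov` at `(D, F)` is proved by cases:

* `D` does not fire: `J D = S D` and `K D = Q D` along `S D`-a.e. stopped past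
  (`stub_fatSurgeryMarkovKernelAE`: renewal + firing-tip lemma + slit-trace lemma);
* `D` fires and its chord meets `F`: the stop is deterministic and
  `K D p₀ = (J D).map (startFrom F)` (`MarkovChord`);
* `D` fires, the chord misses `F` and lands at `b`: `J D` is the Dirac chord, both sides are
  indicators;
* `D` fires, the chord misses `F`, landing point `q ≠ b`: `J D = (S E).map (firePrefix D)` for the
  crosscut domain `E`; lower integrals against the push-forward are pulled back along the prefix
  (`stub_fatSurgeryMarkovTransfer`), stopping/restarting commute with prefixing and the remaining
  domain of a prefixed past is the remaining domain in `E` (`stub_fatSurgeryMarkovPrefix`), so the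
  identity reduces to `S`'s own Markov property in `E` plus kernel agreement in the non-firing
  domain `E` (`stub_fatSurgeryMarkovKernelAE`).
The two deterministic inputs (generalized tip separation, slit trace) enter only through
`stub_fatSurgeryMarkovKernelAE`; the registered stub keeps them as (unused) hypotheses.
-/

noncomputable section

open Set Filter Topology Metric MeasureTheory
open scoped unitInterval ENNReal

namespace Summit.CriticalPhenomena.CardyFormulaZ2.Theorems.CardyRotToConfR2SymmetryUpgrade

open Literature.Probability.RandomPlanarGeometry Literature.Probability.RandomPlanarGeometry.ChordalFamily
open Summit.CriticalPhenomena.CardyFormulaZ2.Theorems.CardyRotToConfR2SymmetryUpgrade.Negative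

namespace MarkovCore

variable {S : ChordalFamily} {Q : DobrushinDomain → CurveClass ℂ → Measure (CurveClass ℂ)}

section Markov

variable (hS : IsLocalMarkovChordalFamily S) (hQ : S.IsMarkovExtension Q)
  (hQn : ∀ (D : DobrushinDomain) (p : CurveClass ℂ), p.target = D.pt 1 →
    Q D p = Measure.dirac (CurveClass.mk (Curve.const (D.pt 1))))
  (hseg : ∀ D : DobrushinDomain, ∀ᵐ γ ∂(S D), ∀ c : Curve ℂ, CurveClass.mk c = γ →
    ∀ s t : I, s < t → Collinear ℝ (c '' Icc s t) → (c '' Icc s t).Subsingleton)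
  (hnull : ∀ D : DobrushinDomain, ∀ᵐ γ ∂(S D), volume γ.range = 0)
  {D : DobrushinDomain} {F : Set ℂ} (hF : IsClosed F)
  {A B : Set (CurveClass ℂ)} (hA : MeasurableSet A) (hB : MeasurableSet B)
include hS hQ hQn hseg hnull hF hA hB

/-- **Non-firing domains.** `J D = S D` and the kernels agree a.s. [folklore] -/
theorem markov_of_not_fires (hD : ¬ Fires D.carrier (D.pt 0)) :
    fatSurgery S D (CurveClass.stopAt F ⁻¹' A ∩ CurveClass.startFrom F ⁻¹' B) =
      ∫⁻ γ in CurveClass.stopAt F ⁻¹' A, surgExt S Q D (CurveClass.stopAt F γ) B ∂(fatSurgery S D) := by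
  rw [fatSurgery_of_not_fires hD, hQ.markov D F hF A B hA hB]
  refine lintegral_congr_ae (ae_restrict_of_ae ?_)
  filter_upwards [stub_fatSurgeryMarkovKernelAE S Q hS hQ hQn hseg hnull D hD F hF] with γ hγ
  rw [hγ]

omit hQ hQn hseg hnull in
/-- **Firing domain, chord meets `F`.** [folklore] -/
theorem markov_of_hit (h : Fires D.carrier (D.pt 0)) (hhit : ∃ t, fireChord D t ∈ F) :
    fatSurgery S D (CurveClass.stopAt F ⁻¹' A ∩ CurveClass.startFrom F ⁻¹' B) =
      ∫⁻ γ in CurveClass.stopAt F ⁻¹' A, surgExt S Q D (CurveClass.stopAt F γ) B ∂(fatSurgery S D) := by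
  have _ := hA
  haveI := isProbabilityMeasure_fatSurgery hS.isChordal D
  have hmem : fireChord D ⟨(fireChord D).hitParam F, (fireChord D).hitParam_mem_Icc F⟩ ∈ F :=
    Curve.apply_hitParam_mem hF hhit
  have hstop := FatSurgeryLocal.ae_stopAt_fatSurgery_eq hS.isChordal h hF rfl hmem
  exact MarkovChord.markov_of_ae_stopAt_eq hF hstop
    (MarkovChord.surgExt_stopAt_chord_eq_map hS h hF hhit) hB

omit hQ hQn hseg hnull in
/-- **Firing domain, chord misses `F`, landing at `b`.** The Dirac chord. [folklore] -/
theorem markov_of_miss_of_eq (h : Fires D.carrier (D.pt 0)) (hmiss : ∀ t, fireChord D t ∉ F)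
    (hq : firePt D = D.pt 1) :
    fatSurgery S D (CurveClass.stopAt F ⁻¹' A ∩ CurveClass.startFrom F ⁻¹' B) =
      ∫⁻ γ in CurveClass.stopAt F ⁻¹' A, surgExt S Q D (CurveClass.stopAt F γ) B ∂(fatSurgery S D) := by
  have _ := hA
  haveI := isProbabilityMeasure_fatSurgery hS.isChordal D
  have h1 : (fireChord D).hitParam F = 1 := Curve.hitParam_eq_one_of_forall_notMem hmiss
  have hstop : ∀ᵐ γ ∂(fatSurgery S D), CurveClass.stopAt F γ = CurveClass.mk (fireChord D) := by
    rw [fatSurgery_of_eq h hq, ae_dirac_eq, eventually_pure, CurveClass.stopAt_mk_holds F hF,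
      Curve.stopAt_eq_self_of_hitParam_eq_one h1]
  refine MarkovChord.markov_of_ae_stopAt_eq hF hstop ?_ hB
  rw [MarkovChord.surgExt_chord_of_eq hq, fatSurgery_of_eq h hq,
    MarkovChord.map_startFrom_dirac_chord hF h1, hq]

/-- **Firing domain, chord misses `F`, landing point `q ≠ b`.** Reduction to `S`'s Markov
property in the crosscut domain `E = fireDom h hq`. [folklore] -/
theorem markov_of_miss_of_ne (h : Fires D.carrier (D.pt 0)) (hmiss : ∀ t, fireChord D t ∉ F)
    (hq : firePt D ≠ D.pt 1) :
    fatSurgery S D (CurveClass.stopAt F ⁻¹' A ∩ CurveClass.startFrom F ⁻¹' B) =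
      ∫⁻ γ in CurveClass.stopAt F ⁻¹' A, surgExt S Q D (CurveClass.stopAt F γ) B ∂(fatSurgery S D) := by
  have hEq : (fireDom h hq).pt 0 = firePt D := pt_zero_fireDom h hq
  have hsrc : ∀ᵐ ξ ∂(S (fireDom h hq)), ξ.source = firePt D := by
    filter_upwards [(hS.isChordal (fireDom h hq)).2] with ξ hξ
    rw [hξ.1, hEq]
  have hEfire : ¬ Fires (fireDom h hq).carrier ((fireDom h hq).pt 0) := by
    rw [hEq]; exact not_fires_fireDom h hq
  -- commutation of stop/restart with the prefix, a.s.
  have hcomm : ∀ᵐ ξ ∂(S (fireDom h hq)),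
      CurveClass.stopAt F (firePrefix D ξ) = firePrefix D (CurveClass.stopAt F ξ) ∧
      CurveClass.startFrom F (firePrefix D ξ) = CurveClass.startFrom F ξ := by
    filter_upwards [hsrc] with ξ hξ
    exact ⟨FatSurgeryLocal.stopAt_firePrefix_of_forall_notMem hF (fun s => hmiss s) hξ,
      (stub_fatSurgeryMarkovPrefix).2.2.1 D F hF hmiss ξ hξ⟩
  have hAπ : MeasurableSet (firePrefix D ⁻¹' A) := hA.preimage (measurable_firePrefix D)
  rw [fatSurgery_of_ne h hq]
  -- left-hand side: `S`'s Markov property in `E`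
  have hL : (S (fireDom h hq)).map (firePrefix D)
        (CurveClass.stopAt F ⁻¹' A ∩ CurveClass.startFrom F ⁻¹' B) =
      ∫⁻ ξ in CurveClass.stopAt F ⁻¹' (firePrefix D ⁻¹' A),
        Q (fireDom h hq) (CurveClass.stopAt F ξ) B ∂(S (fireDom h hq)) := by
    rw [Measure.map_apply (measurable_firePrefix D)
      ((measurableSet_preimage_stopAt hF hA).inter (measurableSet_preimage_startFrom hF hB)),
      ← hQ.markov (fireDom h hq) F hF (firePrefix D ⁻¹' A) B hAπ hB]
    refine measure_congr (Filter.eventuallyEq_set.2 ?_)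
    filter_upwards [hcomm] with ξ hξ
    show firePrefix D ξ ∈ CurveClass.stopAt F ⁻¹' A ∩ CurveClass.startFrom F ⁻¹' B ↔
      ξ ∈ CurveClass.stopAt F ⁻¹' (firePrefix D ⁻¹' A) ∩ CurveClass.startFrom F ⁻¹' B
    simp only [mem_preimage, mem_inter_iff, hξ.1, hξ.2]
  rw [hL]
  -- right-hand side: pull back along the prefix, then identify the kernel
  have hT := stub_fatSurgeryMarkovTransfer D (S (fireDom h hq)) h hsrc
    (fun γ => surgExt S Q D (CurveClass.stopAt F γ) B) (CurveClass.stopAt F ⁻¹' A)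
    (measurableSet_preimage_stopAt hF hA)
  rw [hT]
  have hset : (firePrefix D ⁻¹' (CurveClass.stopAt F ⁻¹' A) : Set (CurveClass ℂ)) =ᵐ[S (fireDom h hq)]
      CurveClass.stopAt F ⁻¹' (firePrefix D ⁻¹' A) := by
    refine Filter.eventuallyEq_set.2 ?_
    filter_upwards [hcomm] with ξ hξ
    show firePrefix D ξ ∈ CurveClass.stopAt F ⁻¹' A ↔ ξ ∈ CurveClass.stopAt F ⁻¹' (firePrefix D ⁻¹' A)
    simp only [mem_preimage, hξ.1]
  rw [setLIntegral_congr hset]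
  refine (lintegral_congr_ae (ae_restrict_of_ae ?_)).symm
  filter_upwards [hcomm, hsrc, stub_fatSurgeryMarkovKernelAE S Q hS hQ hQn hseg hnull
    (fireDom h hq) hEfire F hF] with ξ hξ hξs hK
  -- `K D (π p) = K E p = Q E p` for `p = stopAt F ξ`
  have hps : (CurveClass.stopAt F ξ).source = firePt D := by rw [CurveClass.source_stopAt, hξs]
  show surgExt S Q D (CurveClass.stopAt F (firePrefix D ξ)) B = Q (fireDom h hq) (CurveClass.stopAt F ξ) B
  rw [hξ.1, ← hK, surgExt, surgExt, (stub_fatSurgeryMarkovPrefix).1 D h hq _ hps,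
    target_firePrefix D hps, pt_one_fireDom h hq]

omit hF hA hB in
/-- **The disintegration at every `(D, F)`.** [folklore] -/
theorem markov (D : DobrushinDomain) (F : Set ℂ) (hF : IsClosed F) (A B : Set (CurveClass ℂ))
    (hA : MeasurableSet A) (hB : MeasurableSet B) :
    fatSurgery S D (CurveClass.stopAt F ⁻¹' A ∩ CurveClass.startFrom F ⁻¹' B) =
      ∫⁻ γ in CurveClass.stopAt F ⁻¹' A, surgExt S Q D (CurveClass.stopAt F γ) B ∂(fatSurgery S D) := by
  by_cases h : Fires D.carrier (D.pt 0)
  · by_cases hhit : ∃ t, fireChord D t ∈ F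
    · exact markov_of_hit hS hF hA hB h hhit
    · push Not at hhit
      by_cases hq : firePt D = D.pt 1
      · exact markov_of_miss_of_eq hS hF hA hB h hhit hq
      · exact markov_of_miss_of_ne hS hQ hQn hseg hnull hF hA hB h hhit hq
  · exact markov_of_not_fires hS hQ hQn hseg hnull hF hA hB h

end Markov

end MarkovCore

open MarkovCore in
/-- **The fat-germ one-shot surgery of an admissible, segment-free, range-null family reaching its
target only at the end is domain Markov**, with kernel `Negative.surgExt S Q` for a normalised
Markov extension `Q` of `S`. [folklore] -/
theorem isDomainMarkov_fatSurgery {S : ChordalFamily} (hS : IsLocalMarkovChordalFamily S)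
    (hseg : ∀ D : DobrushinDomain, ∀ᵐ γ ∂(S D), ∀ c : Curve ℂ, CurveClass.mk c = γ →
      ∀ s t : I, s < t → Collinear ℝ (c '' Icc s t) → (c '' Icc s t).Subsingleton)
    (hnull : ∀ D : DobrushinDomain, ∀ᵐ γ ∂(S D), volume γ.range = 0)
    (hend : NoEarlyTarget S) : (fatSurgery S).IsDomainMarkov := by
  obtain ⟨Q, hQ, hQn⟩ := exists_isMarkovExtension_normalized hS.markov hend
  exact ⟨surgExt S Q, ⟨fun D => surgExt_initial hS.isLocal D,
    fun D F hF A B hA hB => markov hS hQ hQn hseg hnull D F hF A B hA hB, surgExt_domain⟩⟩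

/-- **Stub `stub_fatSurgeryMarkovCore`** (lead, line `germ-label-transport`): given generalized
tip separation and the slit-trace lemma (both landed; they enter through
`stub_fatSurgeryMarkovKernelAE`), the fat surgery of an admissible, non-tracing, segment-free,
range-null family reaching its target only at the end is domain Markov. [folklore] -/
theorem stub_fatSurgeryMarkovCore : (∀ (U V : DobrushinDomain) (K : Set ℂ), V.carrier ⊆ U.carrier → V.pt 1 = U.pt 1 → IsConnected K → K ⊆ closure U.carrier → V.pt 0 ∈ K → (∃ k ∈ K, k ≠ V.pt 0) → Disjoint K V.carrier → (∀ ε : ℝ, 0 < ε → (∃ s ∈ Set.Ioo (V.mark 0) (V.mark 0 + ε), V.boundary s ∈ frontier U.carrier ∧ V.boundary s ∉ K) ∧ (∃ s ∈ Set.Ioo (V.mark 0 - ε) (V.mark 0), V.boundary s ∈ frontier U.carrier ∧ V.boundary s ∉ K)) → False) → (∀ (D D₁ : DobrushinDomain) (F : Set ℂ), IsClosed F → Summit.CriticalPhenomena.CardyFormulaZ2.Theorems.CardyRotToConfR2SymmetryUpgrade.Negative.Fires D₁.carrier (D₁.pt 0) → ∀ s : unitInterval, 0 < (s : ℝ) →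 (s : ℝ) < 1 → ∀ γ : CurveClass ℂ, γ.source = D.pt 0 → remainingDomain D (CurveClass.stopAt F γ) = D₁.carrier \ segment ℝ (D₁.pt 0) (Summit.CriticalPhenomena.CardyFormulaZ2.Theorems.CardyRotToConfR2SymmetryUpgrade.Negative.fireChord D₁ s) → (CurveClass.stopAt F γ).target = Summit.CriticalPhenomena.CardyFormulaZ2.Theorems.CardyRotToConfR2SymmetryUpgrade.Negative.fireChord D₁ s → ∃ c : Curve ℂ, CurveClass.mk c = γ ∧ ∃ s' t' : unitInterval, s' < t' ∧ Collinear ℝ (c '' Set.Icc s' t') ∧ ¬ (c '' Set.Icc s' t').Subsingleton) → ∀ S : ChordalFamily, IsLocalMarkovChordalFamily S → (∀ D : DobrushinDomain, ∀ᵐ γ ∂(S D), ∀ c : Curve ℂ, CurveClass.mk c = γ → ∀ s t : unitInterval, s < t → c '' Set.Icc s t ⊆ frontier D.carrier → (c '' Set.Icc s t).Subsingleton) → (∀ D : DobrushinDomain, ∀ᵐ γ ∂(S D), ∀ c : Curve ℂ, CurveClass.mk c = γ → ∀ s t : unitInterval, s < t → Collinear ℝ (c '' Set.Icc s t) → (c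 '' Set.Icc s t).Subsingleton) → (∀ D : DobrushinDomain, ∀ᵐ γ ∂(S D), MeasureTheory.volume γ.range = 0) → (∀ D : DobrushinDomain, ∀ᵐ γ ∂(S D), ∀ c : Curve ℂ, CurveClass.mk c = γ → ∀ s t : unitInterval, s ≤ t → c s = D.pt 1 → c t = D.pt 1) → (Summit.CriticalPhenomena.CardyFormulaZ2.Theorems.CardyRotToConfR2SymmetryUpgrade.Negative.fatSurgery S).IsDomainMarkov :=
  fun _ _ _ hS _ hseg hnull hend => isDomainMarkov_fatSurgery hS hseg hnull hend

end Summit.CriticalPhenomena.CardyFormulaZ2.Theorems.CardyRotToConfR2SymmetryUpgrade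

end
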